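import Literature.MathematicalPhysics.QuantumFieldTheory.BalabanImbrieJaffe1984to88.BIJ88SmoothClassCalculus306
import Literature.MathematicalPhysics.QuantumFieldTheory.BalabanImbrieJaffe1984to88.BIJ88SlotFactorsSmooth308

/-!
# `BalabanImbrieJaffe1984to88.BIJ88ProductRuleAllOrders306` — T. Bałaban, J. Imbrie, A. Jaffe, *Effective action and cluster properties of
the abelian Higgs model*, Commun. Math. Phys. **114** (1988) 257–315 [BalabanImbrieJaffe1988]: pp. 305–306 [PDF 49–50] (Sect. 5.13) with
p. 308 [PDF 52] (Sect. 5.14) — **THE ITERATED FIELD DERIVATIVES OF THE TRAINS DISTRIBUTE OVER THE FACTORS (LEIBNIZ, ALL ORDERS)**.  Print,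
p. 305: *"We integrate by parts all fields appearing in this formula. Each Φ contracts through a C_s to another Φ, to an f(□_i)_s or to ℱ."*;
p. 306, (5.13.3): the trains *"⟨δ/δΦ, C_s □Δ□ C_s ⋯ C_s(½δ/δΦ + ℱ)⟩"* act on the product `Π_{i∈I} f(□_i)`; p. 304: *"f(□_i) is the product of all
the factors under the dμ … integral above that are localized in □_i"*; p. 308: in Sect. 5.14 each factor is itself the product of the located
slots *"(d/dt)_γ acts only on the t before a particular term V^{(k)}(Y) in Ṽ^{(k)} or in a particular χ-factor"*.  So every term of (5.13.3)
is an ITERATED directional derivative (p13's `BIJ88WickSourceSmooth305.dset u D`: the legs `j ∈ D` with directions `u_j`) of a finite PRODUCT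
of smooth factors, and the estimate of p. 307 (*"Functional derivatives hitting χ-factors … hitting e^{−V^{(k)}(Y)} …"*) is organised by WHICH
FACTOR EACH δ/δΦ HITS.  THIS FILE proves that bookkeeping identity at all orders:

  `∂_{u_D} Π_{τ∈T} f_τ = Σ_{g : D → T} Π_{τ∈T} ∂_{u_{g⁻¹(τ)}} f_τ`

(sum over the assignments of legs to factors; each factor receives the iterated derivative along the legs assigned to it), for factors in
the class `C_b^∞` of p13's walk form (`BIJ88SmoothFactors5133.CbInf`), together with the all-orders CHAIN RULE for a factor that is a
one-variable profile of a LINEAR slot field, `∂_{u_D}[g ∘ ℓ] = g^{(|D|)}(ℓ(·))·Π_{j∈D} ℓ(u_j)` — the shape of every located χ-slot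
`∂_t^m χ(c_b·p(te_k), Φ_b(·))` (`BIJ88SlotFactorsSmooth308`, `BIJ88ChiMixedDerivN309`).

statement-level skeleton of published theorems with citation tags; proofs where landed; nothing here is a claim about the Yang–Mills mass gap

PDF held: `paper:balaban1988-cmp114-bij-abelian-higgs-effective-action` (journal page = PDF page + 256); pages re-read this session as text:
PDF 49 (p. 305) L40–43, PDF 51 (p. 307) L5–18, PDF 52 (p. 308) L28–29.

CITATION HEADER (lean-in-tree rule).  Part of the lit-balaban TYPED SKELETON (HOME `run/shared/lean/pub/lit-balaban/`), Phase 2, seat p36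
(gen 21, unit `lit-balaban-p36`); rows **C2.Eq5.14.3-5.14.4** (member: §f brick 7 — distributing the train derivatives of the located
(5.13.3) `BIJ88WalkFormLocated309` over cubes and slots, all orders; companions `BIJ88CubeProductFDeriv306` (orders 1, 2 over the cubes),
`BIJ88ChiMixedDerivN309` (cost per χ-slot), `BIJ88GaussMultiShell307` (Gaussian integration)) and C2.Eq5.13.3-5.13.4 (member: calculus of
p13's `dset` on products) of `HOME/lit-balaban-r16/ROWS-C2-part2.md`.
WHAT IS REPRODUCED (theorem-only; no definitions, no `Prop` facts; axioms standard):
* §1 `isSmoothClass_span_cbInf` (the span of `C_b^∞` is one of p13's linear smooth classes), `cbInf_dset` (`∂_{u_D}` preserves `C_b^∞`),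
  `contDiff_dset`;
* §2 `fderiv_prod_eq_sum_update` (first-order Leibniz in the "one factor replaced by its derivative" form);
* §3 assignments `g : κ → σ` supported on `D` with values in `T` (`Fintype.piFinset`, dummy value `τ₀` off `D`, as p13's colourings
  `BIJ88TrainPieces306.col`): `mem_asg`, `sum_asg_insert`;
* §4 **`dset_prod_apply`** — the display;
* §5 `dset_mul_const`, **`dset_comp_linear`** (`∂_{u_D}[g ∘ ℓ](φ) = g^{(|D|)}(ℓφ)·Π_{j∈D}ℓ(u_j)`), `abs_dset_comp_linear_le`;
* §6 ON THE CELL'S OBJECTS: **`dset_fD_uD_apply`** — the iterated derivative of a cube's located slot product `fD_K(□_i)` of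
  `BIJ88Expansion5143Gauss.fD`/`BIJ88SlotMomentsGauss308.uD` is the assignment sum over the slots located in `□_i`.
HONEST SCOPE.  Identities only; no estimate, no expectation; the cube level (`obs X` through `ext`, with locality pruning the assignments)
is `BIJ88CubeProductFDeriv306` at orders ≤ 2 and the successor's at all orders.
-/

namespace Literature.MathematicalPhysics.QuantumFieldTheory.BalabanImbrieJaffe1984to88.BIJ88ProductRuleAllOrders306

open Finset Function
open scoped BigOperators ContDiff
open BIJ88WickSourceSmooth305 (dset dset_empty dset_insert_max)
open BIJ88SmoothClassCalculus306 (IsSmoothClass isSmoothClass_span)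
open BIJ88SmoothFactors5133 (CbInf)

variable {S : Type} [Fintype S]

/-! ## §1 The class spanned by `C_b^∞`; `∂_{u_D}` preserves smoothness -/

section Class

/-- the linear span of `C_b^∞` is a linear class of smooth factors in p13's sense (`Nice`, closed under `∂_u`).
[cite: BalabanImbrieJaffe1988, §5.13 p.305] -/
theorem isSmoothClass_span_cbInf : IsSmoothClass (Submodule.span ℝ {G : (S → ℝ) → ℝ | CbInf G}) :=
  isSmoothClass_span (fun G => CbInf G) (fun _ hG => hG.nice) (fun _ u hG => hG.fderiv_apply u)

/-- members of `C_b^∞` lie in the span. [cite: BalabanImbrieJaffe1988, §5.13 p.305] -/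
theorem subset_span_cbInf {G : (S → ℝ) → ℝ} (hG : CbInf G) : G ∈ Submodule.span ℝ {G : (S → ℝ) → ℝ | CbInf G} :=
  Submodule.subset_span hG

variable {κ : Type} [LinearOrder κ]

/-- `∂_{u_D}` preserves `C_b^∞`. [cite: BalabanImbrieJaffe1988, §5.13 p.306] -/
theorem cbInf_dset (u : κ → S → ℝ) (D : Finset κ) {G : (S → ℝ) → ℝ} (hG : CbInf G) : CbInf (dset u D G) := by
  induction D using Finset.induction_on_max generalizing G with
  | empty => rwa [dset_empty]
  | insert a s ha ih => rw [dset_insert_max u ha]; exact ih (hG.fderiv_apply (u a))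

/-- a directional derivative of a `C^∞` function of the field is `C^∞`. [cite: BalabanImbrieJaffe1988, §5.13 p.306] -/
theorem contDiff_fderiv_apply {G : (S → ℝ) → ℝ} (hG : ContDiff ℝ ∞ G) (v : S → ℝ) :
    ContDiff ℝ ∞ fun φ => fderiv ℝ G φ v :=
  (hG.fderiv_right (m := ∞) le_rfl).clm_apply contDiff_const

/-- `∂_{u_D}` preserves `C^∞`. [cite: BalabanImbrieJaffe1988, §5.13 p.306] -/
theorem contDiff_dset (u : κ → S → ℝ) (D : Finset κ) {G : (S → ℝ) → ℝ} (hG : ContDiff ℝ ∞ G) : ContDiff ℝ ∞ (dset u D G) := by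
  induction D using Finset.induction_on_max generalizing G with
  | empty => rwa [dset_empty]
  | insert a s ha ih => rw [dset_insert_max u ha]; exact ih (contDiff_fderiv_apply hG (u a))

end Class

/-! ## §2 First order: Leibniz for a finite product, one factor replaced by its derivative -/

section FirstOrder

variable {σ : Type} [DecidableEq σ]

/-- **Leibniz, first order**: `∂_v Π_{τ∈T} f_τ = Σ_{σ∈T} Π_{τ∈T} f^{σ}_τ` with `f^{σ}_σ = ∂_v f_σ`, `f^{σ}_τ = f_τ` (`τ ≠ σ`) — the δ/δΦ hits
one factor (p. 305 *"Each Φ contracts … to an f(□_i)_s"*). [cite: BalabanImbrieJaffe1988, §5.13 p.305] -/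
theorem fderiv_prod_eq_sum_update (T : Finset σ) (f : σ → (S → ℝ) → ℝ) (hf : ∀ τ ∈ T, Differentiable ℝ (f τ)) (v φ : S → ℝ) :
    fderiv ℝ (fun ψ => ∏ τ ∈ T, f τ ψ) φ v =
      ∑ σ' ∈ T, ∏ τ ∈ T, update f σ' (fun ψ => fderiv ℝ (f σ') ψ v) τ φ := by
  have h := HasFDerivAt.finsetProd (u := T) (g := f) (g' := fun τ => fderiv ℝ (f τ) φ) (x := φ)
    fun τ hτ => (hf τ hτ φ).hasFDerivAt
  rw [h.fderiv]
  simp only [_root_.sum_apply, _root_.smul_apply, smul_eq_mul]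
  refine Finset.sum_congr rfl fun σ' hσ' => ?_
  rw [← Finset.mul_prod_erase T _ hσ', update_self,
    Finset.prod_congr rfl fun τ hτ => show update f σ' (fun ψ => fderiv ℝ (f σ') ψ v) τ φ = f τ φ by
      rw [update_of_ne (Finset.ne_of_mem_erase hτ)]]
  ring

end FirstOrder

/-! ## §3 Assignments of legs to factors -/

section Assignments

variable {κ : Type} [LinearOrder κ] [Fintype κ] {σ : Type}

/-- membership in the assignment set: values in `T` on `D`, the dummy value `τ₀` off `D`. [cite: BalabanImbrieJaffe1988, §5.13 p.306] -/
theorem mem_asg {T : Finset σ} {τ₀ : σ} {D : Finset κ} {g : κ → σ} :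
    g ∈ Fintype.piFinset (fun j => if j ∈ D then T else {τ₀}) ↔ (∀ j ∈ D, g j ∈ T) ∧ ∀ j ∉ D, g j = τ₀ := by
  rw [Fintype.mem_piFinset]
  constructor
  · intro h
    refine ⟨fun j hj => ?_, fun j hj => ?_⟩
    · have := h j; rwa [if_pos hj] at this
    · have := h j; rwa [if_neg hj, Finset.mem_singleton] at this
  · rintro ⟨h1, h2⟩ j
    by_cases hj : j ∈ D
    · rw [if_pos hj]; exact h1 j hj
    · rw [if_neg hj, Finset.mem_singleton]; exact h2 j hj

/-- **splitting off the assignment of one leg**: `Σ_{g : D∪{a} → T} F(g) = Σ_{σ∈T} Σ_{g : D → T} F(g[a ↦ σ])` (`a ∉ D`) — p13's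
`BIJ88TrainPieces306.sum_col_insert` for assignments. [cite: BalabanImbrieJaffe1988, §5.13 p.306] -/
theorem sum_asg_insert {M : Type*} [AddCommMonoid M] (T : Finset σ) (τ₀ : σ) {D : Finset κ} {a : κ} (ha : a ∉ D)
    (F : (κ → σ) → M) :
    ∑ g ∈ Fintype.piFinset (fun j => if j ∈ insert a D then T else {τ₀}), F g =
      ∑ σ' ∈ T, ∑ g ∈ Fintype.piFinset (fun j => if j ∈ D then T else {τ₀}), F (update g a σ') := by
  rw [← sum_product' (s := T) (t := Fintype.piFinset (fun j => if j ∈ D then T else {τ₀})) (f := fun σ' g => F (update g a σ'))]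
  refine (sum_nbij' (fun p => update p.2 a p.1) (fun g => (g a, update g a τ₀)) ?_ ?_ ?_ ?_ ?_).symm
  · intro p hp
    rw [mem_product, mem_asg] at hp
    rw [mem_asg]
    refine ⟨fun j hj => ?_, fun j hj => ?_⟩
    · rcases Finset.mem_insert.1 hj with rfl | hjD
      · rw [update_self]; exact hp.1
      · rw [update_of_ne (ne_of_mem_of_not_mem hjD ha)]; exact hp.2.1 j hjD
    · rw [Finset.mem_insert, not_or] at hj
      rw [update_of_ne hj.1]; exact hp.2.2 j hj.2
  · intro g hg
    rw [mem_asg] at hg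
    rw [mem_product, mem_asg]
    refine ⟨hg.1 a (Finset.mem_insert_self a D), fun j hj => ?_, fun j hj => ?_⟩
    · show update g a τ₀ j ∈ T
      rw [update_of_ne (ne_of_mem_of_not_mem hj ha)]; exact hg.1 j (Finset.mem_insert_of_mem hj)
    · show update g a τ₀ j = τ₀
      by_cases h : j = a
      · subst h; rw [update_self]
      · rw [update_of_ne h]; exact hg.2 j (by rw [Finset.mem_insert, not_or]; exact ⟨h, hj⟩)
  · intro p hp
    rw [mem_product, mem_asg] at hp
    refine Prod.ext (by simp) ?_
    simp only [update_idem]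
    exact update_eq_self_iff.2 (hp.2.2 a ha).symm
  · intro g _
    simp only [update_idem, update_eq_self_iff]
  · intro p _
    rfl

end Assignments

/-! ## §4 All orders: `∂_{u_D} Π_τ f_τ = Σ_{g : D → T} Π_τ ∂_{u_{g⁻¹τ}} f_τ` -/

section AllOrders

variable {κ : Type} [LinearOrder κ] [Fintype κ] {σ : Type} [DecidableEq σ]

/-- **LEIBNIZ AT ALL ORDERS — WHICH FACTOR EACH δ/δΦ HITS** (p. 305 *"Each Φ contracts through a C_s to another Φ, to an f(□_i)_s or to ℱ"*;
p. 307 *"Functional derivatives hitting χ-factors … hitting e^{−V^{(k)}(Y)} …"*): for factors `f_τ ∈ C_b^∞`, `τ ∈ T`, legs `D` with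
directions `u`, and every field `φ`,
`∂_{u_D}[Π_{τ∈T} f_τ](φ) = Σ_{g} Π_{τ∈T} ∂_{u_{D ∩ g⁻¹τ}} f_τ(φ)`, the sum over the assignments `g` of the legs in `D` to factors in `T`
(dummy value `τ₀` off `D`). [cite: BalabanImbrieJaffe1988, §5.13 Eq. (5.13.3) p.306, p.307] -/
theorem dset_prod_apply (u : κ → S → ℝ) (T : Finset σ) (τ₀ : σ) (D : Finset κ) (f : σ → (S → ℝ) → ℝ)
    (hf : ∀ τ ∈ T, CbInf (f τ)) (φ : S → ℝ) :
    dset u D (fun ψ => ∏ τ ∈ T, f τ ψ) φ =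
      ∑ g ∈ Fintype.piFinset (fun j => if j ∈ D then T else {τ₀}), ∏ τ ∈ T, dset u (D.filter fun j => g j = τ) (f τ) φ := by
  induction D using Finset.induction_on_max generalizing f φ with
  | empty =>
    have hA : Fintype.piFinset (fun j : κ => if j ∈ (∅ : Finset κ) then T else {τ₀}) = {fun _ => τ₀} := by
      rw [← Fintype.piFinset_singleton]
      exact congrArg Fintype.piFinset (funext fun j => by rw [if_neg (Finset.notMem_empty j)])
    rw [dset_empty, hA, Finset.sum_singleton]
    exact Finset.prod_congr rfl fun τ _ => by rw [Finset.filter_empty, dset_empty]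
  | insert a D ha ih =>
    have haD : a ∉ D := fun h => lt_irrefl a (ha a h)
    have hcl := isSmoothClass_span_cbInf (S := S)
    -- the family with the factor `σ'` differentiated along `u a`
    set fa : σ → σ → (S → ℝ) → ℝ := fun σ' => update f σ' (fun ψ => fderiv ℝ (f σ') ψ (u a)) with hfa
    have hfa_mem : ∀ σ' ∈ T, ∀ τ ∈ T, CbInf (fa σ' τ) := fun σ' hσ' τ hτ => by
      by_cases h : τ = σ'
      · subst h; rw [hfa]; dsimp only; rw [update_self]; exact (hf τ hτ).fderiv_apply (u a)
      · rw [hfa]; dsimp only; rw [update_of_ne h]; exact hf τ hτ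
    -- Leibniz at first order, as an identity of functions
    have hfirst : (fun φ => fderiv ℝ (fun ψ => ∏ τ ∈ T, f τ ψ) φ (u a)) = ∑ σ' ∈ T, fun φ => ∏ τ ∈ T, fa σ' τ φ := by
      funext φ
      rw [Finset.sum_apply]
      exact fderiv_prod_eq_sum_update T f (fun τ hτ => (hf τ hτ).1.differentiable (by simp)) (u a) φ
    rw [dset_insert_max u ha, hfirst, hcl.dset_sum u D T _ (fun σ' hσ' => subset_span_cbInf
      (BIJ88SmoothFactors5133.CbInf.prod T fun τ hτ => hfa_mem σ' hσ' τ hτ)), Finset.sum_apply,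
      sum_asg_insert T τ₀ haD]
    refine Finset.sum_congr rfl fun σ' hσ' => ?_
    rw [ih (fa σ') (hfa_mem σ' hσ')]
    refine Finset.sum_congr rfl fun g _ => Finset.prod_congr rfl fun τ _ => ?_
    -- compare the fibres of `g` and of `g[a ↦ σ']`
    have hfib : D.filter (fun j => update g a σ' j = τ) = D.filter (fun j => g j = τ) :=
      Finset.filter_congr fun j hj => by rw [update_of_ne (ne_of_mem_of_not_mem hj haD)]
    by_cases hτ : τ = σ'
    · subst hτ
      rw [Finset.filter_insert, if_pos (update_self ..), hfib, hfa]
      dsimp only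
      rw [update_self, dset_insert_max u (fun x hx => ha x (Finset.mem_of_mem_filter x hx))]
    · rw [Finset.filter_insert, if_neg (by rw [update_self]; exact Ne.symm hτ), hfib, hfa]
      dsimp only
      rw [update_of_ne hτ]

end AllOrders

/-! ## §5 The chain rule at all orders for a profile of a linear slot field -/

section Chain

variable {κ : Type} [LinearOrder κ]

/-- `∂_{u_D}[H · c] = (∂_{u_D} H) · c` for `C^∞` `H`. [cite: BalabanImbrieJaffe1988, §5.13 p.306] -/
theorem dset_mul_const (u : κ → S → ℝ) (D : Finset κ) {H : (S → ℝ) → ℝ} (hH : ContDiff ℝ ∞ H) (c : ℝ) :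
    dset u D (fun φ => H φ * c) = fun φ => dset u D H φ * c := by
  induction D using Finset.induction_on_max generalizing H with
  | empty => simp only [dset_empty]
  | insert a s ha ih =>
    rw [dset_insert_max u ha, dset_insert_max u ha]
    have h1 : (fun φ => fderiv ℝ (fun φ => H φ * c) φ (u a)) = fun φ => fderiv ℝ H φ (u a) * c := by
      funext φ
      rw [fderiv_mul_const ((hH.differentiable (by simp)) φ)]
      simp only [_root_.smul_apply, smul_eq_mul, mul_comm c]
    rw [h1, ih (contDiff_fderiv_apply hH (u a))]

/-- **THE CHAIN RULE AT ALL ORDERS for a one-variable profile of a LINEAR slot field**: for `g : ℝ → ℝ` smooth and `ℓ` linear,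
`∂_{u_D}[g ∘ ℓ](φ) = g^{(|D|)}(ℓ(φ)) · Π_{j∈D} ℓ(u_j)` — each leg hitting the located χ-slot `∂_t^m χ(c_b·p(te_k), Φ_b(·))` differentiates
the profile once and brings the coefficient `Φ_b(u_j)` (p. 307: *"Factorials can be produced when many functional derivatives hit the same
object, for example a characteristic function"*). [cite: BalabanImbrieJaffe1988, §5.13 p.307, (5.14.3) p.309] -/
theorem dset_comp_linear (u : κ → S → ℝ) {g : ℝ → ℝ} (hg : ContDiff ℝ ∞ g) {ℓ : (S → ℝ) → ℝ} (hℓ : IsLinearMap ℝ ℓ) (D : Finset κ) :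
    dset u D (fun φ => g (ℓ φ)) = fun φ => iteratedDeriv D.card g (ℓ φ) * ∏ j ∈ D, ℓ (u j) := by
  induction D using Finset.induction_on_max generalizing g with
  | empty => funext φ; simp [dset_empty]
  | insert a s ha ih =>
    have haD : a ∉ s := fun h => lt_irrefl a (ha a h)
    set L : (S → ℝ) →L[ℝ] ℝ := LinearMap.toContinuousLinearMap (IsLinearMap.mk' ℓ hℓ) with hL
    have hgd : Differentiable ℝ g := hg.differentiable (by simp)
    have h1 : (fun φ => fderiv ℝ (fun φ => g (ℓ φ)) φ (u a)) = fun φ => deriv g (ℓ φ) * ℓ (u a) := by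
      funext φ
      have hcomp : HasFDerivAt (g ∘ L) (deriv g (L φ) • L) φ := (hgd _).hasDerivAt.comp_hasFDerivAt φ L.hasFDerivAt
      rw [show (fun φ => g (ℓ φ)) = g ∘ L from rfl, hcomp.fderiv]
      rfl
    have hg1 : ContDiff ℝ ∞ (deriv g) := hg.iterate_deriv 1
    have hcomp1 : ContDiff ℝ ∞ fun φ : S → ℝ => deriv g (ℓ φ) := hg1.comp L.contDiff
    rw [dset_insert_max u ha, h1, dset_mul_const u s hcomp1 (ℓ (u a)), ih hg1]
    funext φ
    rw [Finset.card_insert_of_notMem haD, iteratedDeriv_succ', Finset.prod_insert haD]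
    ring

/-- hence a bound on the `n`-th derivatives of the profile is a bound on the iterated field derivative:
`|∂_{u_D}[g ∘ ℓ](φ)| ≤ B_{|D|}(ℓφ) · Π_{j∈D} |ℓ(u_j)|`. [cite: BalabanImbrieJaffe1988, §5.13 p.307, (5.14.3) p.309] -/
theorem abs_dset_comp_linear_le (u : κ → S → ℝ) {g : ℝ → ℝ} (hg : ContDiff ℝ ∞ g) {ℓ : (S → ℝ) → ℝ} (hℓ : IsLinearMap ℝ ℓ)
    (D : Finset κ) {B : ℕ → ℝ → ℝ} (hB : ∀ n x, |iteratedDeriv n g x| ≤ B n x) (φ : S → ℝ) :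
    |dset u D (fun φ => g (ℓ φ)) φ| ≤ B D.card (ℓ φ) * ∏ j ∈ D, |ℓ (u j)| := by
  rw [dset_comp_linear u hg hℓ D]
  dsimp only
  rw [abs_mul, Finset.abs_prod]
  exact mul_le_mul_of_nonneg_right (hB _ _) (Finset.prod_nonneg fun j _ => abs_nonneg _)

end Chain

/-! ## §6 On the cell's objects: the located slot product of one cube -/

section Located

open BIJ88Sect5Statements (CutoffProfile)
open BIJ88Expansion5143Gauss (fD)
open BIJ88SlotMomentsGauss308 (uD)

variable {κ : Type} [LinearOrder κ] [Fintype κ]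
variable (χ : CutoffProfile) {ι υ : Type} [DecidableEq ι] [DecidableEq υ] (p : ℝ) {ek t : ℝ} (B : Finset ι)
  {Φ : ι → (S → ℝ) → ℝ} {c : ι → ℝ} (Ys : Finset υ) {V : υ → (S → ℝ) → ℝ} {I : Type} [DecidableEq I]
  (cube : ↥B ⊕ ↥Ys → I) {L : Type*} (γ : L → ↥B ⊕ ↥Ys)

/-- **THE ITERATED FIELD DERIVATIVE OF A CUBE'S LOCATED SLOT PRODUCT IS THE ASSIGNMENT SUM OVER ITS SLOTS**: for the located derivative
observable `fD_K(□_i) = Π_{τ : cube τ = i} ∂_t^{#K at τ}(slot τ)` of p. 308 (`BIJ88Expansion5143Gauss.fD` on `BIJ88SlotMomentsGauss308.uD`;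
linear slot fields, `c_b ≠ 0`, `V_Y ∈ C_b^∞`, `t` on the branch) and legs `D` with directions `u`:
`∂_{u_D}[fD_K(□_i)](φ) = Σ_{g : D → slots of □_i} Π_{τ} ∂_{u_{g⁻¹τ}}[∂_t^{#K at τ}(slot τ)](φ)` — each leg hits one located slot
(χ-slot: `BIJ88ChiMixedDerivN309`, §5; `V`-slot: `∂_{u_D}` of `(−V_Y)^m e^{−tV_Y}`). [cite: BalabanImbrieJaffe1988, §5.13 p.307, (5.14.3) p.308–309] -/
theorem dset_fD_uD_apply (hek : 0 < ek) (ht : 0 < t) (h1 : t * ek < 1) (hΦ : ∀ b ∈ B, IsLinearMap ℝ (Φ b))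
    (hc : ∀ b ∈ B, c b ≠ 0) (hV : ∀ Y ∈ Ys, CbInf (V Y)) (K : Finset L) (i : I) (τ₀ : ↥B ⊕ ↥Ys) (u : κ → S → ℝ)
    (D : Finset κ) (φ : S → ℝ) :
    dset u D (fD (uD χ p ek B Φ c Ys V t) cube γ K i) φ =
      ∑ g ∈ Fintype.piFinset (fun j => if j ∈ D then univ.filter (fun τ => cube τ = i) else {τ₀}),
        ∏ τ ∈ univ.filter (fun τ => cube τ = i),
          dset u (D.filter fun j => g j = τ) (uD χ p ek B Φ c Ys V t τ (K.filter fun j => γ j = τ).card) φ := by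
  have h := dset_prod_apply u (univ.filter fun τ => cube τ = i) τ₀ D
    (fun τ => uD χ p ek B Φ c Ys V t τ (K.filter fun j => γ j = τ).card) (fun τ _ => ?_) φ
  · exact h
  · rcases τ with ⟨b, hb⟩ | ⟨Y, hY⟩
    · exact BIJ88SlotFactorsSmooth308.cbInf_uD_inl χ p B Ys hek ht h1 ⟨b, hb⟩ (hΦ b hb) (hc b hb) _
    · exact BIJ88SlotFactorsSmooth308.cbInf_uD_inr χ p B Ys ⟨Y, hY⟩ (hV Y hY) _

end Located

end Literature.MathematicalPhysics.QuantumFieldTheory.BalabanImbrieJaffe1984to88.BIJ88ProductRuleAllOrders306
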